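import Summits.Ventures.PercRepro.C041PortProblemCaseII

/-!
# The port problem of THEOREM R: CASE (iv), gates of both pure types, and the four-way split (p6, gen 23)

Setting of `C041PortProblemDefs` / `C041PortProblemCaseII` (mine-3, C-041.md §3 (iv) / §6 (c)).  A PURE-TYPE gate carries
one terminal edge only (`k₁ = true, k₂ = false` or the reverse).  The paper's count for case (iv) («all gates switchable of
pure types») is a 1-to-3 charging of the CLOSED colouring of two gates:

* **both types present** (`phi_nonneg_of_pure_gates_mixed`): gates `g₁` of type 1 and `g₂` of type 2; the patterns with
  both gate edges red have weight `4`, those with one red have weight `≥ 1` (the red gate edge gives the opposite side by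
  the KEY FACT — a pure-type gate is never deleted on the side it does not carry), the closed one `≥ −2` and injects into
  the first class by reddening both edges;
* **two gates of the same pure type** (`phi_nonneg_of_pure_gates_same`): every colouring opening a gate has weight `≥ 1`
  and the closed colouring injects into each of the three open ones, so `Φ ≥ #RR + #RB + #BR − 2·#BB ≥ 0`.

Together with cases (ii) and (iii) this leaves, for the LEMMA `0 ≤ Φ P`, exactly the paper's case (v): a UNIQUE gate,
switchable, of pure type — the sub-problem `Γ − R₀` rooted at it (proofs/P6-THEOREM-R-LEAN-PLAN.md).  Both results hold
for any validity predicate kept by reddening, hence for `Φ∨` and `Φ∧`.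
-/

namespace PercRepro

namespace PortProblem

namespace Problem

open Finset

variable {V : Type*} {P : Problem V}

/-- A port without a 2-edge is never deleted on side `2`. -/
theorem not_mem_A₂_of_no_two {x : P.Term → Bool} {p : V} (hk : P.k₂ p = false) : p ∉ P.A₂ x := by
  rintro ⟨e, he, _⟩
  have h := e.2.2.2 (by rw [he])
  rw [he] at h
  rw [h] at hk
  exact Bool.noConfusion hk

/-- A port without a 1-edge is never deleted on side `1`. -/
theorem not_mem_A₁_of_no_one {x : P.Term → Bool} {p : V} (hk : P.k₁ p = false) : p ∉ P.A₁ x := by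
  rintro ⟨e, he, _⟩
  have h := e.2.2.1 (by rw [he])
  rw [he] at h
  rw [h] at hk
  exact Bool.noConfusion hk

/-- **A red 1-edge at a type-`{1}` gate gives `Good₂`.** -/
theorem good₂_of_red_pure_gate {x : P.Term → Bool} {e : P.Term} (hp : P.IsGate e.1.1)
    (he : e.1.2 = false) (hk : P.k₂ e.1.1 = false) (hx : x e = true) : P.Good₂ x :=
  ⟨e, he, hx, reach_gate (A₂_subset x) hp (not_mem_A₂_of_no_two hk)⟩

/-- **A red 2-edge at a type-`{2}` gate gives `Good₁`.** -/
theorem good₁_of_red_pure_gate {x : P.Term → Bool} {e : P.Term} (hp : P.IsGate e.1.1)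
    (he : e.1.2 = true) (hk : P.k₁ e.1.1 = false) (hx : x e = true) : P.Good₁ x :=
  ⟨e, he, hx, reach_gate (A₁_subset x) hp (not_mem_A₁_of_no_one hk)⟩

open Classical in
/-- A Good side gives weight `≥ 1`. -/
theorem one_le_weight_of_good {x : P.Term → Bool} (h : P.Good₁ x ∨ P.Good₂ x) : 1 ≤ P.weight x := by
  unfold weight
  rcases h with h | h
  · rw [if_pos h]
    split_ifs <;> omega
  · rw [if_pos h]
    split_ifs <;> omega

open Classical in
/-- Both sides Good give weight `4`. -/
theorem weight_eq_four_of_good {x : P.Term → Bool} (h₁ : P.Good₁ x) (h₂ : P.Good₂ x) : P.weight x = 4 := by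
  unfold weight
  rw [if_pos h₁, if_pos h₂]
  norm_num

section Update

variable [DecidableEq V]

/-- Reddening two edges is injective on the patterns with common values at both. -/
theorem update2_injOn (e f : P.Term) (v w : Bool) :
    Set.InjOn (fun x : P.Term → Bool => Function.update (Function.update x e true) f true)
      {x | x e = v ∧ x f = w} := by
  intro x hx y hy hxy
  funext g
  by_cases hgf : g = f
  · rw [hgf]
    exact hx.2.trans hy.2.symm
  · by_cases hge : g = e
    · rw [hge]
      exact hx.1.trans hy.1.symm
    · have := congrFun hxy g
      simp only [Function.update_of_ne hgf, Function.update_of_ne hge] at this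
      exact this

end Update

section Sums

variable [Fintype V] [DecidableEq V]

open Classical in
/-- The four-way split of the pattern sum along two distinct terminal edges `e, f`. -/
theorem sum_split_four (val : (P.Term → Bool) → Prop) (e f : P.Term) :
    (∑ x : P.Term → Bool, if P.Adm x ∧ val x then P.weight x else 0) =
      ∑ x ∈ (univ.filter fun x : P.Term → Bool => (P.Adm x ∧ val x) ∧ x e = true ∧ x f = true),
          P.weight x +
        ∑ x ∈ (univ.filter fun x : P.Term → Bool => (P.Adm x ∧ val x) ∧ x e = true ∧ x f = false),
          P.weight x +
        ∑ x ∈ (univ.filter fun x : P.Term → Bool => (P.Adm x ∧ val x) ∧ x e = false ∧ x f = true),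
          P.weight x +
        ∑ x ∈ (univ.filter fun x : P.Term → Bool => (P.Adm x ∧ val x) ∧ x e = false ∧ x f = false),
          P.weight x := by
  set S := (univ : Finset (P.Term → Bool)).filter fun x => P.Adm x ∧ val x with hS
  have h1 : (S.filter fun x => x e = true).filter (fun x => x f = true) =
      univ.filter fun x : P.Term → Bool => (P.Adm x ∧ val x) ∧ x e = true ∧ x f = true := by
    ext x
    simp only [hS, mem_filter, mem_univ, true_and, and_assoc]
  have h2 : (S.filter fun x => x e = true).filter (fun x => ¬ x f = true) =
      univ.filter fun x : P.Term → Bool => (P.Adm x ∧ val x) ∧ x e = true ∧ x f = false := by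
    ext x
    simp only [hS, mem_filter, mem_univ, true_and, and_assoc, Bool.not_eq_true]
  have h3 : (S.filter fun x => ¬ x e = true).filter (fun x => x f = true) =
      univ.filter fun x : P.Term → Bool => (P.Adm x ∧ val x) ∧ x e = false ∧ x f = true := by
    ext x
    simp only [hS, mem_filter, mem_univ, true_and, and_assoc, Bool.not_eq_true]
  have h4 : (S.filter fun x => ¬ x e = true).filter (fun x => ¬ x f = true) =
      univ.filter fun x : P.Term → Bool => (P.Adm x ∧ val x) ∧ x e = false ∧ x f = false := by
    ext x
    simp only [hS, mem_filter, mem_univ, true_and, and_assoc, Bool.not_eq_true]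
  rw [← Finset.sum_filter, ← hS, ← Finset.sum_filter_add_sum_filter_not S (fun x => x e = true),
    ← Finset.sum_filter_add_sum_filter_not (S.filter fun x => x e = true) (fun x => x f = true),
    ← Finset.sum_filter_add_sum_filter_not (S.filter fun x => ¬ x e = true) (fun x => x f = true),
    h1, h2, h3, h4, add_assoc, add_assoc, add_assoc]

omit [Fintype V] [DecidableEq V] in
/-- A class sum is at least its lower bound times its size. -/
theorem card_mul_le_sum_of_forall {s : Finset (P.Term → Bool)} {b : ℤ} (h : ∀ x ∈ s, b ≤ P.weight x) :
    b * (s.card : ℤ) ≤ ∑ x ∈ s, P.weight x := by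
  calc b * (s.card : ℤ) = ∑ _x ∈ s, b := by rw [Finset.sum_const, nsmul_eq_mul, mul_comm]
    _ ≤ ∑ x ∈ s, P.weight x := Finset.sum_le_sum h

open Classical in
/-- **CASE (iv), both pure types present**: a gate of type `{1}` and a gate of type `{2}` give `0 ≤ Φ`. -/
theorem phi_nonneg_of_pure_gates_mixed (val : (P.Term → Bool) → Prop)
    (hval : ∀ x e, val x → val (Function.update x e true))
    {e₁ e₂ : P.Term} (hp₁ : P.IsGate e₁.1.1) (hp₂ : P.IsGate e₂.1.1)
    (he₁ : e₁.1.2 = false) (he₂ : e₂.1.2 = true)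
    (hk₁ : P.k₂ e₁.1.1 = false) (hk₂ : P.k₁ e₂.1.1 = false) :
    0 ≤ ∑ x : P.Term → Bool, if P.Adm x ∧ val x then P.weight x else 0 := by
  rw [sum_split_four val e₁ e₂]
  set RR := univ.filter fun x : P.Term → Bool => (P.Adm x ∧ val x) ∧ x e₁ = true ∧ x e₂ = true with hRR
  set RB := univ.filter fun x : P.Term → Bool => (P.Adm x ∧ val x) ∧ x e₁ = true ∧ x e₂ = false with hRB
  set BR := univ.filter fun x : P.Term → Bool => (P.Adm x ∧ val x) ∧ x e₁ = false ∧ x e₂ = true with hBR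
  set BB := univ.filter fun x : P.Term → Bool => (P.Adm x ∧ val x) ∧ x e₁ = false ∧ x e₂ = false with hBB
  have hne : e₁ ≠ e₂ := by
    intro h
    rw [h] at he₁
    rw [he₁] at he₂
    exact Bool.noConfusion he₂
  have hRRw : 4 * (RR.card : ℤ) ≤ ∑ x ∈ RR, P.weight x := by
    apply card_mul_le_sum_of_forall
    intro x hx
    rw [hRR, mem_filter] at hx
    rw [weight_eq_four_of_good (good₁_of_red_pure_gate hp₂ he₂ hk₂ hx.2.2.2)
      (good₂_of_red_pure_gate hp₁ he₁ hk₁ hx.2.2.1)]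
  have hRBw : 1 * (RB.card : ℤ) ≤ ∑ x ∈ RB, P.weight x := by
    apply card_mul_le_sum_of_forall
    intro x hx
    rw [hRB, mem_filter] at hx
    exact one_le_weight_of_good (Or.inr (good₂_of_red_pure_gate hp₁ he₁ hk₁ hx.2.2.1))
  have hBRw : 1 * (BR.card : ℤ) ≤ ∑ x ∈ BR, P.weight x := by
    apply card_mul_le_sum_of_forall
    intro x hx
    rw [hBR, mem_filter] at hx
    exact one_le_weight_of_good (Or.inl (good₁_of_red_pure_gate hp₂ he₂ hk₂ hx.2.2.2))
  have hBBw : -2 * (BB.card : ℤ) ≤ ∑ x ∈ BB, P.weight x :=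
    card_mul_le_sum_of_forall fun x _ => neg_two_le_weight x
  have hBBc : BB.card ≤ RR.card := by
    refine card_le_card_of_injOn
      (fun x => Function.update (Function.update x e₁ true) e₂ true) ?_ ?_
    · intro x hx
      rw [hBB, coe_filter] at hx
      rw [hRR, coe_filter]
      refine ⟨mem_univ _, ⟨adm_update_true (adm_update_true hx.2.1.1 e₁) e₂,
        hval _ e₂ (hval x e₁ hx.2.1.2)⟩, ?_, ?_⟩
      · show Function.update (Function.update x e₁ true) e₂ true e₁ = true
        rw [Function.update_of_ne hne]
        exact Function.update_self ..
      · show Function.update (Function.update x e₁ true) e₂ true e₂ = true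
        exact Function.update_self ..
    · intro x hx y hy hxy
      rw [hBB, coe_filter] at hx hy
      exact update2_injOn e₁ e₂ false false ⟨hx.2.2.1, hx.2.2.2⟩ ⟨hy.2.2.1, hy.2.2.2⟩ hxy
  have hc : (BB.card : ℤ) ≤ RR.card := by exact_mod_cast hBBc
  linarith

omit [Fintype V] in
/-- Validity `X₁ ∨ X₂` is kept by reddening. -/
theorem valOr_update (x : P.Term → Bool) (e : P.Term) (h : P.X₁ x ∨ P.X₂ x) :
    P.X₁ (Function.update x e true) ∨ P.X₂ (Function.update x e true) :=
  h.elim (fun h' => Or.inl (X₁_update_true h' e)) (fun h' => Or.inr (X₂_update_true h' e))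

omit [Fintype V] in
/-- Validity `X₁ ∧ X₂` is kept by reddening. -/
theorem valAnd_update (x : P.Term → Bool) (e : P.Term) (h : P.X₁ x ∧ P.X₂ x) :
    P.X₁ (Function.update x e true) ∧ P.X₂ (Function.update x e true) :=
  ⟨X₁_update_true h.1 e, X₂_update_true h.2 e⟩

open Classical in
/-- **CASE (iv), `Φ∨`, both pure types present.** -/
theorem phiOr_nonneg_of_pure_gates_mixed {g₁ g₂ : V} (hp₁ : P.IsGate g₁) (hp₂ : P.IsGate g₂)
    (hk₁ : P.k₁ g₁ = true) (hk₁' : P.k₂ g₁ = false) (hk₂ : P.k₂ g₂ = true) (hk₂' : P.k₁ g₂ = false) :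
    0 ≤ P.phiOr := by
  let e₁ : P.Term := ⟨(g₁, false), hp₁.mem, fun _ => hk₁, fun h => Bool.noConfusion h⟩
  let e₂ : P.Term := ⟨(g₂, true), hp₂.mem, fun h => Bool.noConfusion h, fun _ => hk₂⟩
  unfold phiOr
  convert phi_nonneg_of_pure_gates_mixed (fun x => P.X₁ x ∨ P.X₂ x) valOr_update
    (e₁ := e₁) (e₂ := e₂) hp₁ hp₂ rfl rfl hk₁' hk₂' using 3

open Classical in
/-- **CASE (iv), `Φ∧`, both pure types present.** -/
theorem phiAnd_nonneg_of_pure_gates_mixed {g₁ g₂ : V} (hp₁ : P.IsGate g₁) (hp₂ : P.IsGate g₂)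
    (hk₁ : P.k₁ g₁ = true) (hk₁' : P.k₂ g₁ = false) (hk₂ : P.k₂ g₂ = true) (hk₂' : P.k₁ g₂ = false) :
    0 ≤ P.phiAnd := by
  let e₁ : P.Term := ⟨(g₁, false), hp₁.mem, fun _ => hk₁, fun h => Bool.noConfusion h⟩
  let e₂ : P.Term := ⟨(g₂, true), hp₂.mem, fun h => Bool.noConfusion h, fun _ => hk₂⟩
  unfold phiAnd
  convert phi_nonneg_of_pure_gates_mixed (fun x => P.X₁ x ∧ P.X₂ x) valAnd_update
    (e₁ := e₁) (e₂ := e₂) hp₁ hp₂ rfl rfl hk₁' hk₂' using 3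


end Sums

end Problem

end PortProblem

end PercRepro
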